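import Summits.AtomisticToContinuum.FouriersLaw.Theorems.OddSectorIrreversibilityTapLeakBoundSplitGlue
import Summits.AtomisticToContinuum.FouriersLaw.Theorems.OddSectorIrreversibilityTapLeakBoundPositionTapGlue
import Summits.AtomisticToContinuum.FouriersLaw.Theorems.OddSectorIrreversibilityTapLeakBoundKickCone
import Summits.AtomisticToContinuum.FouriersLaw.Theorems.OddSectorIrreversibilityTapLeakBoundHermiteOfMixedTap

/-!
# Strategist split for crux `TapLeakBound` (P, stmt-AtomisticToContinuum-15159) — crux-strategist s1, 2026-08-17

DECOMPOSITION `P ⇐ H1 ∧ C′` prepared for `ledger route edit route-AtomisticToContinuum-OddSectorIrreversibility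
--split TapLeakBound --into children.json --glue-by
Summit.AtomisticToContinuum.FouriersLaw.Theorems.OddSectorIrreversibility.TapLeak.tapLeakBound_of_hermite_of_kickCone`
(the command bounced for this seat: `--split` is reserved by the gate to a seat's FINAL cycle; `children.json` with the
two statements below, informal text, why-might-fail and sources is attached as evidence on the item; the lead's final
cycle or the tenure planner files it — see `STRATEGY-CENSUS.md` §Decomposition). Namespace is this workfile's own, so the
child names cannot clash with the route file once the split is filed there.

The two children of the decomposition `P ⇐ H1 ∧ C′`, typed in the ROUTE FILE's vocabulary (fully
qualified, `let` spelling, exactly as they will be written by `route edit --split TapLeakBound`), and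
the composition `TapLeakBound_of_subs : BoundaryHermiteRegularity → ResampledKickCone → TapLeakBound`
obtained from the landed glue `tapLeakBound_of_hermite_of_kickCone` (p122261) by definitional unfolding.
Also: the stronger corrector child PTB implies H1 over landed lemmas (documentation of the line
`Lines/SketchIdeator2.lean` as a line on the child H1).
-/

namespace Summit.AtomisticToContinuum.FouriersLaw.Cruxes.TapLeakBound.StrategistSplit

open scoped BigOperators Topology Manifold Classical MeasureTheory ProbabilityTheory Matrix InnerProductSpace ComplexConjugate ContinuousMap
open Filter Set Function TopologicalSpace MeasureTheory

/-- Child 1 (H1, corrector side): boundary Hermite regularity of the even corrector at budget scale. -/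
def BoundaryHermiteRegularity : Prop :=
  ∀ ω₂ lam β γ : ℝ, 0 < ω₂ → 0 < lam → 0 < β → 0 < γ → ∀ T : ℝ, 0 < T → ∃ C : ℝ, ∀ (N : ℕ) (b : Fin N) (u : Literature.MathematicalPhysics.KineticTheory.HeatConduction.PhaseSpace N → ℝ), (b.val = 0 ∨ b.val = N - 1) → let P := Literature.MathematicalPhysics.KineticTheory.HeatConduction.pinnedChain ω₂ lam β γ; let μT : MeasureTheory.Measure (Literature.MathematicalPhysics.KineticTheory.HeatConduction.PhaseSpace N) := MeasureTheory.volume.withDensity (fun x : Literature.MathematicalPhysics.KineticTheory.HeatConduction.PhaseSpace N => ENNReal.ofReal (Real.exp (-(P.hamiltonian N x) / T))); let J : Literature.MathematicalPhysics.KineticTheory.HeatConduction.PhaseSpace N → ℝ := fun z => ∑ k : Fin N, P.bondCurrent N k z; let ue : Literature.MathematicalPhysics.KineticTheory.HeatConduction.PhaseSpace N → ℝ := fun x => (u x + u (x.1, -x.2)) / 2; let Nue : Literature.MathematicalPhysics.KineticTheory.HeatConduction.PhaseSpace N → ℝ := fun x => -(T * Literature.MathematicalPhysics.KineticTheory.HeatConduction.partialP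 b (Literature.MathematicalPhysics.KineticTheory.HeatConduction.partialP b ue) x) + x.2 b * Literature.MathematicalPhysics.KineticTheory.HeatConduction.partialP b ue x; ContDiff ℝ 1 u → MeasureTheory.MemLp u 2 μT → (∀ᵐ x ∂μT, Filter.Tendsto (fun τ : ℝ => ∫ t in Set.Ioc (0 : ℝ) τ, (∫ y, J y ∂(P.transitionKernel N T T t.toNNReal x))) Filter.atTop (nhds (u x))) → MeasureTheory.MemLp Nue 2 μT ∧ ∫ x, (Nue x) ^ 2 ∂μT ≤ C * (|∫ x, u x * J x ∂μT| + ∫ x, Real.exp (-(P.hamiltonian N x) / T) ∂MeasureTheory.volume)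

/-- Child 2 (C′, flow side): the resampled-kick `L²(Gibbs)` light cone of the closed chain, linear window, order 3. -/
def ResampledKickCone : Prop :=
  ∀ ω₂ lam β γ : ℝ, 0 < ω₂ → 0 < lam → 0 < β → 0 < γ → ∀ T : ℝ, 0 < T → ∃ a C : ℝ, 0 < a ∧ ∀ (N : ℕ) (i b : Fin N) (s : ℝ), (b.val = 0 ∨ b.val = N - 1) → 0 ≤ s → let P := Literature.MathematicalPhysics.KineticTheory.HeatConduction.pinnedChain ω₂ lam β γ; let P₀ := Literature.MathematicalPhysics.KineticTheory.HeatConduction.pinnedChain ω₂ lam β 0; let μT : MeasureTheory.Measure (Literature.MathematicalPhysics.KineticTheory.HeatConduction.PhaseSpace N) := MeasureTheory.volume.withDensity (fun x : Literature.MathematicalPhysics.KineticTheory.HeatConduction.PhaseSpace N => ENNReal.ofReal (Real.exp (-(P.hamiltonian N x) / T))); let js : Literature.MathematicalPhysics.KineticTheory.HeatConduction.PhaseSpace N → ℝ := fun x => ∫ y, P.bondCurrent N i y ∂(P₀.transitionKernel N T T s.toNNReal x); let d : ℕ := (if b.val = 0 then i.val else N - 2 - i.val); s ≤ a * (d : ℝ)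 → ∫ x, (∫ p', (js (x.1, Function.update x.2 b p') - js x) ^ 2 ∂(ProbabilityTheory.gaussianReal 0 (Real.toNNReal T))) ∂μT ≤ C * (∫ x, Real.exp (-(P.hamiltonian N x) / T) ∂MeasureTheory.volume) / (1 + ((d : ℝ) - s / a)) ^ 3

/-- The stronger, first-order corrector child of line `SketchIdeator2` v11 (stub PTB, position tap budget). -/
def PositionTapBudget : Prop :=
  ∀ ω₂ lam β γ : ℝ, 0 < ω₂ → 0 < lam → 0 < β → 0 < γ → ∀ T : ℝ, 0 < T → ∃ C : ℝ, ∀ (N : ℕ) (b : Fin N) (u : Literature.MathematicalPhysics.KineticTheory.HeatConduction.PhaseSpace N → ℝ), (b.val = 0 ∨ b.val = N - 1) → ContDiff ℝ 1 u → MeasureTheory.MemLp u 2 (Summit.AtomisticToContinuum.FouriersLaw.Theorems.OddSectorWitness.gibbsWeight ω₂ lam β γ N T) → (∀ᵐ x ∂(Summit.AtomisticToContinuum.FouriersLaw.Theorems.OddSectorWitness.gibbsWeight ω₂ lam β γ N T), Filter.Tendsto (fun τ : ℝ => ∫ t in Set.Ioc (0 : ℝ) τ, (∫ y, (∑ k :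 Fin N, (Literature.MathematicalPhysics.KineticTheory.HeatConduction.pinnedChain ω₂ lam β γ).bondCurrent N k y) ∂((Literature.MathematicalPhysics.KineticTheory.HeatConduction.pinnedChain ω₂ lam β γ).transitionKernel N T T t.toNNReal x))) Filter.atTop (nhds (u x))) → MeasureTheory.MemLp (Literature.MathematicalPhysics.KineticTheory.HeatConduction.partialQ b u) 2 (Summit.AtomisticToContinuum.FouriersLaw.Theorems.OddSectorWitness.gibbsWeight ω₂ lam β γ N T) ∧ ∫ x, (Literature.MathematicalPhysics.KineticTheory.HeatConduction.partialQ b u x) ^ 2 ∂(Summit.AtomisticToContinuum.FouriersLaw.Theorems.OddSectorWitness.gibbsWeight ω₂ lam β γ N T) ≤ C * (|∫ x, u x * (∑ k : Fin N, (Literature.MathematicalPhysics.KineticTheory.HeatConduction.pinnedChain ω₂ lam β γ).bondCurrent N k x) ∂(Summit.AtomisticToContinuum.FouriersLaw.Theorems.OddSectorWitness.gibbsWeight ω₂ lam β γ N T)| + ∫ x, Real.exp (-((Literature.MathematicalPhysics.KineticTheory.HeatConduction.pinnedChain ω₂ lam β γ).hamiltonian N x) / T) ∂MeasureTheory.vo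lume)

/-- **The glued split of P, by the landed theorem** (p122261): `H1 → C′ → TapLeakBound`. -/
theorem TapLeakBound_of_subs : BoundaryHermiteRegularity → ResampledKickCone →
    Summit.AtomisticToContinuum.FouriersLaw.Theses.OddSectorIrreversibility.TapLeakBound :=
  Summit.AtomisticToContinuum.FouriersLaw.Theorems.OddSectorIrreversibility.TapLeak.tapLeakBound_of_hermite_of_kickCone

/-- The `let`-free children of the landed glue `tapLeakBound_of_mixedTapBound_of_kickCone` and the line's PTB reduction:
PTB → H1 (documentation: the live skeleton's corrector stub is a line on child H1). -/
theorem boundaryHermiteRegularity_of_positionTapBudget : PositionTapBudget → BoundaryHermiteRegularity := by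
  intro hPTB
  have hM := Summit.AtomisticToContinuum.FouriersLaw.Theorems.OddSectorIrreversibility.TapLeak.stub_mixedTapOfPositionTap hPTB
  exact Summit.AtomisticToContinuum.FouriersLaw.Theorems.OddSectorIrreversibility.TapLeak.boundaryHermiteRegularity_of_mixedTapBound hM

/-- Sanity: the composition concludes the route decl by name. -/
example : BoundaryHermiteRegularity → ResampledKickCone →
    Summit.AtomisticToContinuum.FouriersLaw.Theses.OddSectorIrreversibility.TapLeakBound := TapLeakBound_of_subs

end Summit.AtomisticToContinuum.FouriersLaw.Cruxes.TapLeakBound.StrategistSplit
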